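import Literature.NumberTheory.GaloisRepresentations.ContinuousCorestrictionDoubleCosetFinite
import Literature.NumberTheory.GaloisRepresentations.GaloisCohomologyCorestriction
import Literature.NumberTheory.GaloisRepresentations.LocalInertiaComapRestrict
import Summits.BirchSwinnertonDyer.Rank1Residual.X11b.MaxUnramifiedRestriction
import HarnessLib

/-!
# The corestriction `Cor_{k'/k} : H¹(k', M) → H¹(k, M)` of a finite extension of local fields maps
# unramified classes to unramified classes

Route `KolyvaginRoadThree`, crux `ZhangSharpFrameAtThreeHL` (stmt-BirchSwinnertonDyer-19574), PT road
(C) (koly `PT-ROAD-DESIGN-g19.md` §2, brick N4-local = the binder `hur`/`hurD` of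
`KolyvaginRoadThreePT.middleExact_canonical_of_descentData` up to the twist isomorphisms).  For
non-archimedean local fields `k`, `k'` of characteristic `0` with `k'/k` finite and a discrete
`Γ_k`-module `M` (`σ : DiscreteGaloisModule k M`):

* `cor_mem_unramifiedSubgroup` — **if `z ∈ H¹_ur(k', M) = ker (H¹(k', M) → H¹(k'^{nr}, M))` then
  `Cor_{k'/k} z ∈ H¹_ur(k, M)`** (`galoisCohomology.cor`, p553620).

Proof: `[φ] ∈ H¹_ur ⟺ φ` is principal on the inertia group (x11b3 `LocBridge.mem_unramifiedSubgroup_one_iff_exists`);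
`Cor [φ] = cores [φ̃]` along the open subgroup `res(Γ_{k'}) ≤ Γ_k`; by the double-coset formula
(`resSubgroup_cores_eq_zero_of_doubleCoset`, p552734) with `D = I_k` it suffices that every conjugated
restriction `a ↦ g φ̃(g⁻¹ a g)` on `I_k ∩ g res(Γ_{k'}) g⁻¹` is principal; as `I_k` is normal,
`g⁻¹ a g ∈ I_k ∩ res(Γ_{k'}) = res(I_{k'})` (`I_{k'} = res⁻¹(I_k)`, `mem_absInertia_iff_absGaloisRestrict_mem`),
where `φ` is principal: `g φ(g⁻¹ag) = g((g⁻¹ag) w − w) = a (g w) − g w`.  THEOREMS ONLY; no case of BSD.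

References: [SerreLocalFields1979] I §7 Prop. 22, VII §7; [NeukirchSchmidtWingberg2008] (1.5.6)–(1.5.7);
[MilneADT2006] I §2.
-/

noncomputable section

open CategoryTheory Function
open scoped Classical

set_option linter.dupNamespace false
set_option autoImplicit false

namespace Summit.BirchSwinnertonDyer.BirchSwinnertonDyer.Theorems.KolyvaginRoadThreePT

open Field IsNonarchimedeanLocalField
open Literature.NumberTheory.GaloisRepresentations
open Literature.NumberTheory.GaloisRepresentations.IsNonarchimedeanLocalField
open Summit.BirchSwinnertonDyer.Rank1Residual.X11b

section CorUnramified

variable {k k' : Type} [Field k] [ValuativeRel k] [TopologicalSpace k] [IsNonarchimedeanLocalField k]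
  [CharZero k] [Field k'] [ValuativeRel k'] [TopologicalSpace k'] [IsNonarchimedeanLocalField k']
  [Algebra k k'] [FiniteDimensional k k']
variable {M : Type} [AddCommGroup M] [TopologicalSpace M] [DiscreteTopology M]

/-- **`Cor_{k'/k}` maps `H¹_ur(k', M)` into `H¹_ur(k, M)`** for a finite extension `k'/k` of
non-archimedean local fields of characteristic `0` and a discrete `Γ_k`-module `M`.
[cite: SerreLocalFields1979, Ch. I §7 Prop. 22 a)] [cite: NeukirchSchmidtWingberg2008, I §5 (1.5.6)–(1.5.7)]
[cite: MilneADT2006, Ch. I §2 (unramified cohomology)] -/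
theorem cor_mem_unramifiedSubgroup (σ : DiscreteGaloisModule k M)
    (z : galoisCohomology (σ.restrictField k') 1)
    (hz : z ∈ DiscreteGaloisModule.unramifiedSubgroup (σ.restrictField k') 1) :
    galoisCohomology.cor σ k' z ∈ DiscreteGaloisModule.unramifiedSubgroup σ 1 := by
  haveI : Algebra.IsAlgebraic k k' := Algebra.IsAlgebraic.of_finite k k'
  haveI : (absInertia k).Normal := absInertia_normal_holds k
  -- notation
  set G := absoluteGaloisGroup k
  set H : Subgroup (absoluteGaloisGroup k) := (absGaloisRestrict k k').range with hH_def
  set I : Subgroup (absoluteGaloisGroup k) := absInertia k with hI_def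
  have hHo : IsOpen (H : Set (absoluteGaloisGroup k)) := isOpen_range_absGaloisRestrict k k'
  haveI : Fintype (absoluteGaloisGroup k ⧸ H) := Fintype.ofFinite _
  haveI : Fintype (DoubleCoset.Quotient (I : Set (absoluteGaloisGroup k)) H) :=
    @Fintype.ofFinite _ (finite_doubleCosetQuotient H I)
  haveI : ∀ q : DoubleCoset.Quotient (I : Set (absoluteGaloisGroup k)) H,
      Fintype (I ⧸ (interConj H I q.out).subgroupOf I) := fun q =>
    @Fintype.ofFinite _ (finite_quotient_interConj_subgroupOf H I q.out)
  -- the class as a cocycle, principal on `I_{k'}`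
  obtain ⟨φ, rfl⟩ := oneCocycleClass_surjective (σ.restrictField k').toTopRep z
  obtain ⟨w, hw⟩ := (LocBridge.mem_unramifiedSubgroup_one_iff_exists (σ.restrictField k') φ).mp hz
  -- `Cor [φ] = cores [φ̃]`, `φ̃ h = φ (e⁻¹ h)`
  rw [galoisCohomology.cor_eq_cores_rangeTransport, galoisCohomology.rangeTransport_apply,
    map_oneCocycleClass]
  set φt := contOneCocycles.pullback
    ((absGaloisRangeEquiv k k').symm : (absGaloisRestrict k k').range →ₜ* absoluteGaloisGroup k')
    (rangeTransportHom σ k') φ with hφt_def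
  have hφt : ∀ h : H, φt.1 h = φ.1 ((absGaloisRangeEquiv k k').symm h) := fun _ => rfl
  -- the corestricted class as a cocycle `ψ`; it suffices that `ψ` is principal on `I_k`
  obtain ⟨ψ, hψ⟩ := oneCocycleClass_surjective σ.toTopRep (cores σ.toTopRep H hHo (oneCocycleClass _ φt))
  rw [← hψ]
  refine (LocBridge.mem_unramifiedSubgroup_one_iff_exists σ ψ).mpr ?_
  -- `res_{I_k} (cores [φ̃]) = 0` by the double-coset formula
  have hres : resSubgroup σ.toTopRep I 1 (cores σ.toTopRep H hHo (oneCocycleClass _ φt)) = 0 := by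
    refine resSubgroup_cores_eq_zero_of_doubleCoset H I σ.toTopRep hHo _ fun q => ?_
    rw [conjRes_oneCocycleClass, oneCocycleClass_eq_zero_iff]
    refine ⟨σ q.out w, fun a => ?_⟩
    rw [conjRes_pullback_apply, hφt]
    -- `g⁻¹ a g = res τ'` with `τ' ∈ I_{k'}`
    set τ' : absoluteGaloisGroup k' :=
      (absGaloisRangeEquiv k k').symm (conjResHom H q.out (interConj H I q.out) (fun _ ha => ha.2) a)
      with hτ'_def
    have hτ'res : absGaloisRestrict k k' τ' = (q.out)⁻¹ * (a : absoluteGaloisGroup k) * q.out := by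
      rw [hτ'_def, absGaloisRestrict_absGaloisRangeEquiv_symm, conjResHom_apply_coe]
    have hτ'I : τ' ∈ absInertia k' := by
      rw [mem_absInertia_iff_absGaloisRestrict_mem (F := k), hτ'res]
      have ha : (a : absoluteGaloisGroup k) ∈ absInertia k := ((mem_interConj H I q.out _).mp a.2).1
      exact Subgroup.Normal.conj_mem' inferInstance _ ha q.out
    rw [hw τ' hτ'I, GaloisRep.restrictField_apply, hτ'res]
    change σ.toTopRep.ρ q.out (σ.toTopRep.ρ (q.out⁻¹ * (a : absoluteGaloisGroup k) * q.out) w - w) =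
      σ.toTopRep.ρ (a : absoluteGaloisGroup k) (σ.toTopRep.ρ q.out w) - σ.toTopRep.ρ q.out w
    rw [map_sub, ← ρ_mul_apply, ← ρ_mul_apply]
    have e : q.out * (q.out⁻¹ * (a : absoluteGaloisGroup k) * q.out) =
        (a : absoluteGaloisGroup k) * q.out := by group
    rw [e]
  -- read off the principality on `I_k`
  rw [← hψ, resSubgroup_oneCocycleClass, oneCocycleClass_eq_zero_iff] at hres
  obtain ⟨v, hv⟩ := hres
  exact ⟨v, fun τ hτ => by
    have h := hv ⟨τ, hτ⟩
    rwa [resSubgroup_pullback_apply] at h⟩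

end CorUnramified

end Summit.BirchSwinnertonDyer.BirchSwinnertonDyer.Theorems.KolyvaginRoadThreePT

end
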